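/-
Copyright: rh-split cell (screw, bridge) gen 14, 2026-08-27.  Splitting search over kernel-typed
RH-equivalences; this module is ζ-free analysis.  Nothing here bears on the truth of RH.
-/
import Summits.RiemannHypothesis.RiemannHypothesis.Theorems.Splittings.ScrewBorelContinuationB
import HarnessLib

/-!
# Analytic continuation through an aliased pole field — part C: the main theorem and the walls theorem

Continuation of `ScrewBorelContinuationA` (same namespace `…Splittings.ScrewBorel`; see its module docstring
for the statement and proof outline of the kernel theorem `poleSet_eq_empty` and the walls theorem).
No `sorry`, no new axioms, no instances, no notation.
-/

set_option linter.dupNamespace false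

namespace Summit.RiemannHypothesis.RiemannHypothesis.Theorems.Splittings.ScrewBorel

open Complex Filter Topology Set Metric

/-! ## 6. The main theorem -/

/-- **Analytic continuation through an aliased pole field.**  Let `∑ ‖c i‖ < ∞`, `Re (c i) < 0`,
`u i ≠ 0`; let `F` be complex-differentiable on the open unit disc and equal to the Borel series
`∑' i, term (c i) (u i) z` on a disc `ball 0 r₀` (`r₀ > 0`) containing no inside pole.  If the closure of the
inside pole set is countable inside the disc, then the inside pole set is empty. -/
theorem poleSet_eq_empty {ι : Type*} {c u : ι → ℂ} (hc : Summable fun i ↦ ‖c i‖)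
    (hre : ∀ i, (c i).re < 0) (hu : ∀ i, u i ≠ 0) {F : ℂ → ℂ} (hF : DifferentiableOn ℂ F (ball 0 1))
    {r₀ : ℝ} (hr₀ : 0 < r₀) (hS : ∀ p ∈ poleSet u, r₀ ≤ ‖p‖)
    (hFB : EqOn F (fun z ↦ ∑' i, term (c i) (u i) z) (ball 0 r₀))
    (hcount : (closure (poleSet u) ∩ ball 0 1).Countable) : poleSet u = ∅ := by
  rcases Set.eq_empty_or_nonempty (poleSet u) with h | hne
  · exact h
  exfalso
  have hV := eqOn_borel hc hu hF hr₀ hS hFB hcount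
  obtain ⟨p, hp, ε, hε, hpε, hiso⟩ := exists_isolated_pole hne hcount
  have hC := tsum_poleCoeff_eq_zero hc hu hF hV hp hε hpε hiso
  -- but the real part of the total coefficient is negative
  have hpc : Summable fun i ↦ poleCoeff (c i) (u i) p :=
    Summable.of_norm_bounded hc (fun i ↦ norm_poleCoeff_le _ _ _)
  have hre_sum : Summable fun i ↦ (poleCoeff (c i) (u i) p).re := (Complex.hasSum_re hpc.hasSum).summable
  obtain ⟨i₀, hi₀⟩ := hp.2
  have hlt : ∑' i, (poleCoeff (c i) (u i) p).re < ∑' _ : ι, (0 : ℝ) :=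
    hre_sum.tsum_lt_tsum (fun i ↦ re_poleCoeff_nonpos (hre i) _ _) (re_poleCoeff_neg (hre i₀) hi₀)
      summable_zero
  rw [tsum_zero, ← Complex.re_tsum hpc, hC, Complex.zero_re] at hlt
  exact lt_irrefl _ hlt

/-- Corollary: under the hypotheses of `poleSet_eq_empty`, every `u i` lies ON the unit circle. -/
theorem norm_eq_one_of_countable_closure {ι : Type*} {c u : ι → ℂ} (hc : Summable fun i ↦ ‖c i‖)
    (hre : ∀ i, (c i).re < 0) (hu : ∀ i, u i ≠ 0) {F : ℂ → ℂ} (hF : DifferentiableOn ℂ F (ball 0 1))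
    {r₀ : ℝ} (hr₀ : 0 < r₀) (hS : ∀ p ∈ poleSet u, r₀ ≤ ‖p‖)
    (hFB : EqOn F (fun z ↦ ∑' i, term (c i) (u i) z) (ball 0 r₀))
    (hcount : (closure (poleSet u) ∩ ball 0 1).Countable) : ∀ i, ‖u i‖ = 1 := by
  have hempty := poleSet_eq_empty hc hre hu hF hr₀ hS hFB hcount
  intro i
  by_contra hne
  rcases lt_or_gt_of_ne hne with hlt | hgt
  · have : u i ∈ poleSet u := ⟨hlt, i, Or.inl rfl⟩
    rw [hempty] at this; exact this
  · have hinv : ‖(u i)⁻¹‖ < 1 := by rw [norm_inv]; exact inv_lt_one_of_one_lt₀ hgt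
    have : (u i)⁻¹ ∈ poleSet u := ⟨hinv, i, Or.inr rfl⟩
    rw [hempty] at this; exact this

/-- **The dichotomy** (no countability hypothesis): either there is no inside pole at all, or the closure
of the inside pole set is UNCOUNTABLE inside the disc (the derived set walls off every pole). -/
theorem poleSet_empty_or_uncountable_closure {ι : Type*} {c u : ι → ℂ} (hc : Summable fun i ↦ ‖c i‖)
    (hre : ∀ i, (c i).re < 0) (hu : ∀ i, u i ≠ 0) {F : ℂ → ℂ} (hF : DifferentiableOn ℂ F (ball 0 1))
    {r₀ : ℝ} (hr₀ : 0 < r₀) (hS : ∀ p ∈ poleSet u, r₀ ≤ ‖p‖)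
    (hFB : EqOn F (fun z ↦ ∑' i, term (c i) (u i) z) (ball 0 r₀)) :
    poleSet u = ∅ ∨ ¬ (closure (poleSet u) ∩ ball 0 1).Countable := by
  by_cases hcount : (closure (poleSet u) ∩ ball 0 1).Countable
  · exact Or.inl (poleSet_eq_empty hc hre hu hF hr₀ hS hFB hcount)
  · exact Or.inr hcount

/-! ## 7. WALLS: an isolated inside pole is never adherent to a preconnected region of agreement

The countability hypothesis of `poleSet_eq_empty` is used only to make `ball 0 1 ∖ closure (poleSet u)`
connected and to produce an isolated pole.  The local mechanism is sharper and hypothesis-free: if `F`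
(holomorphic on the disc) agrees with the Borel series near `0`, then NO inside pole `p` that is isolated
in `closure (poleSet u)` can be adherent to a preconnected set `V ∋ 0` avoiding `closure (poleSet u)` —
along `V` the series blows up like `‖C_p‖ ‖p‖ / ‖z - p‖` (`Re C_p < 0`) while `F` stays bounded.  So the
closure of the pole set must SEPARATE `0` from every isolated pole: walls of poles are necessary. -/

/-- The regular part of the Borel series near a pole `p` isolated within `2ε`: summable and bounded by
`2 (∑ ‖c_i‖) / ε` on `‖z - p‖ < ε`. -/
theorem regular_bound {ι : Type*} {c u : ι → ℂ} (hc : Summable fun i ↦ ‖c i‖) (hu : ∀ i, u i ≠ 0)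
    {p : ℂ} {ε : ℝ} (hε : 0 < ε) (hpε : ‖p‖ + 2 * ε < 1)
    (hiso : ∀ q ∈ closure (poleSet u), ‖q - p‖ < 2 * ε → q = p) {z : ℂ} (hz : ‖z - p‖ < ε) :
    (Summable fun i ↦ regTerm (c i) (u i) p z) ∧
      ‖∑' i, regTerm (c i) (u i) p z‖ ≤ 2 * (∑' i, ‖c i‖) / ε := by
  have hzr : ‖z‖ ≤ ‖p‖ + ε := by
    have e : p + (z - p) = z := by ring
    have := norm_add_le p (z - p)
    rw [e] at this; linarith
  have hδr : ε ≤ 1 - (‖p‖ + ε) := by linarith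
  have hb : ∀ i, ‖regTerm (c i) (u i) p z‖ ≤ 2 * ‖c i‖ / ε := by
    intro i
    refine norm_regTerm_le (hu i) hε hδr hzr (fun hne hlt ↦ ?_) (fun hne hlt ↦ ?_)
    · have hq : (u i)⁻¹ ∈ closure (poleSet u) := subset_closure ⟨hlt, i, Or.inr rfl⟩
      have hfar : ¬ ‖(u i)⁻¹ - p‖ < 2 * ε := fun h ↦ hne (hiso _ hq h)
      have e : ((u i)⁻¹ - z) + (z - p) = (u i)⁻¹ - p := by ring
      have := norm_add_le ((u i)⁻¹ - z) (z - p)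
      rw [e] at this
      push Not at hfar
      linarith
    · have hq : u i ∈ closure (poleSet u) := subset_closure ⟨hlt, i, Or.inl rfl⟩
      have hfar : ¬ ‖u i - p‖ < 2 * ε := fun h ↦ hne (hiso _ hq h)
      have e : (u i - z) + (z - p) = u i - p := by ring
      have := norm_add_le (u i - z) (z - p)
      rw [e] at this
      push Not at hfar
      linarith
  have hsn : Summable fun i ↦ ‖regTerm (c i) (u i) p z‖ :=
    Summable.of_nonneg_of_le (fun i ↦ norm_nonneg _) hb ((hc.mul_left 2).div_const ε)
  refine ⟨hsn.of_norm, (norm_tsum_le_tsum_norm hsn).trans ?_⟩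
  calc ∑' i, ‖regTerm (c i) (u i) p z‖ ≤ ∑' i, 2 * ‖c i‖ / ε :=
        hsn.tsum_le_tsum hb ((hc.mul_left 2).div_const ε)
    _ = 2 * (∑' i, ‖c i‖) / ε := by rw [tsum_div_const, tsum_mul_left]

/-- **Walls theorem (ζ-free).**  `c` absolutely summable with `Re c_i < 0`, `u_i ≠ 0`, `F` holomorphic on
the unit disc and equal to the Borel series on a disc `ball 0 r₀` free of poles.  If `V ∋ 0` is a
preconnected subset of `ball 0 1 ∖ closure (poleSet u)` then no inside pole isolated in
`closure (poleSet u)` lies in `closure V`. -/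
theorem not_mem_closure_of_isolated {ι : Type*} {c u : ι → ℂ} (hc : Summable fun i ↦ ‖c i‖)
    (hre : ∀ i, (c i).re < 0) (hu : ∀ i, u i ≠ 0) {F : ℂ → ℂ} (hF : DifferentiableOn ℂ F (ball 0 1))
    {r₀ : ℝ} (hr₀ : 0 < r₀) (hFB : EqOn F (fun z ↦ ∑' i, term (c i) (u i) z) (ball 0 r₀))
    {V : Set ℂ} (hV : IsPreconnected V) (hV0 : (0 : ℂ) ∈ V)
    (hVsub : V ⊆ ball 0 1 \ closure (poleSet u))
    {p : ℂ} (hp : p ∈ poleSet u) {ε : ℝ} (hε : 0 < ε) (hpε : ‖p‖ + 2 * ε < 1)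
    (hiso : ∀ q ∈ closure (poleSet u), ‖q - p‖ < 2 * ε → q = p) : p ∉ closure V := by
  intro hpV
  have hp1 : ‖p‖ < 1 := hp.1
  have hp0 : p ≠ 0 := by
    obtain ⟨i, hi | hi⟩ := hp.2
    · rw [hi]; exact hu i
    · rw [hi]; exact inv_ne_zero (hu i)
  -- `F` equals the Borel series on `V` (identity theorem on the preconnected set `V`)
  have hVopen : IsOpen (ball (0 : ℂ) 1 \ closure (poleSet u)) := isOpen_ball.sdiff isClosed_closure
  have hFan : AnalyticOnNhd ℂ F V :=
    ((hF.mono Set.sdiff_subset).analyticOnNhd hVopen).mono hVsub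
  have hBan : AnalyticOnNhd ℂ (fun z ↦ ∑' i, term (c i) (u i) z) V :=
    ((differentiableOn_borel hc hu).analyticOnNhd hVopen).mono hVsub
  have hev : F =ᶠ[𝓝 0] fun z ↦ ∑' i, term (c i) (u i) z :=
    Filter.eventuallyEq_of_mem (ball_mem_nhds 0 hr₀) hFB
  have hFBV : EqOn F (fun z ↦ ∑' i, term (c i) (u i) z) V :=
    hFan.eqOn_of_preconnected_of_eventuallyEq hBan hV hV0 hev
  -- the total pole coefficient `C` has negative real part, hence `‖C‖ > 0`
  have hpc : Summable fun i ↦ poleCoeff (c i) (u i) p :=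
    Summable.of_norm_bounded hc (fun i ↦ norm_poleCoeff_le _ _ _)
  set C : ℂ := ∑' i, poleCoeff (c i) (u i) p with hC
  have hCre : C.re < 0 := by
    have hre_sum : Summable fun i ↦ (poleCoeff (c i) (u i) p).re :=
      (Complex.hasSum_re hpc.hasSum).summable
    obtain ⟨i₀, hi₀⟩ := hp.2
    have hlt : ∑' i, (poleCoeff (c i) (u i) p).re < ∑' _ : ι, (0 : ℝ) :=
      hre_sum.tsum_lt_tsum (fun i ↦ re_poleCoeff_nonpos (hre i) _ _) (re_poleCoeff_neg (hre i₀) hi₀)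
        summable_zero
    rw [tsum_zero, ← Complex.re_tsum hpc] at hlt
    exact hlt
  have hC0 : 0 < ‖C‖ := by
    refine norm_pos_iff.2 fun h ↦ ?_
    rw [h, Complex.zero_re] at hCre
    exact lt_irrefl _ hCre
  -- bounds: the regular part by `M`, `F` by `‖F p‖ + 1` near `p`
  set M : ℝ := 2 * (∑' i, ‖c i‖) / ε with hM
  have hM0 : 0 ≤ M := by
    have h0 : 0 ≤ ∑' i, ‖c i‖ := tsum_nonneg fun i ↦ norm_nonneg (c i)
    rw [hM]; positivity
  have hFcont : ContinuousAt F p :=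
    hF.continuousOn.continuousAt (isOpen_ball.mem_nhds (mem_ball_zero_iff.2 hp1))
  obtain ⟨η, hη, hFη⟩ := Metric.continuousAt_iff.1 hFcont 1 one_pos
  set L : ℝ := ‖F p‖ + 1 + M with hL
  have hL0 : 0 < L := by rw [hL]; positivity
  -- a point of `V` very close to `p`
  set δ : ℝ := min (min ε η) (‖C‖ * ‖p‖ / L) with hδ
  have hδ0 : 0 < δ := by
    rw [hδ]
    refine lt_min (lt_min hε hη) ?_
    exact div_pos (mul_pos hC0 (norm_pos_iff.2 hp0)) hL0
  obtain ⟨z, hzV, hzd⟩ := Metric.mem_closure_iff.1 hpV δ hδ0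
  have hzp : ‖z - p‖ < δ := by rwa [dist_comm, dist_eq_norm] at hzd
  have hzε : ‖z - p‖ < ε := hzp.trans_le ((min_le_left _ _).trans (min_le_left _ _))
  have hzη : dist z p < η := by
    rw [dist_eq_norm]; exact hzp.trans_le ((min_le_left _ _).trans (min_le_right _ _))
  have hzC : ‖z - p‖ < ‖C‖ * ‖p‖ / L := hzp.trans_le (min_le_right _ _)
  have hzne : z - p ≠ 0 := by
    intro h
    have hzp' : z = p := sub_eq_zero.1 h
    exact (hVsub hzV).2 (hzp' ▸ subset_closure hp)
  have hzn : 0 < ‖z - p‖ := norm_pos_iff.2 hzne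
  -- decomposition of the Borel series at `z`
  obtain ⟨hrs, hrb⟩ := regular_bound hc hu hε hpε hiso hzε
  have hsplit : ∑' i, term (c i) (u i) z = C * (1 - z / p)⁻¹ + ∑' i, regTerm (c i) (u i) p z := by
    have h1 : ∀ i, term (c i) (u i) z =
        poleCoeff (c i) (u i) p * (1 - z / p)⁻¹ + regTerm (c i) (u i) p z :=
      fun i ↦ term_eq_poleCoeff_add_regTerm (c i) (u i) p z
    simp_rw [h1]
    rw [(hpc.mul_right _).tsum_add hrs, tsum_mul_right]
  have hpolar : ‖C * (1 - z / p)⁻¹‖ = ‖C‖ * ‖p‖ / ‖z - p‖ := by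
    have e : (1 - z / p)⁻¹ = p / (p - z) := by
      rw [one_sub_div hp0, inv_div]
    rw [e, norm_mul, norm_div, norm_sub_rev]
    ring
  -- `‖F z‖ ≤ ‖F p‖ + 1`
  have hFb : ‖F z‖ ≤ ‖F p‖ + 1 := by
    have h := hFη hzη
    rw [dist_eq_norm] at h
    have e : F p + (F z - F p) = F z := by ring
    have := norm_add_le (F p) (F z - F p)
    rw [e] at this
    linarith
  -- `‖F z‖ ≥ ‖C‖‖p‖/‖z - p‖ - M > L - M = ‖F p‖ + 1`
  have hFz : F z = ∑' i, term (c i) (u i) z := hFBV hzV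
  have hlow : ‖C‖ * ‖p‖ / ‖z - p‖ - M ≤ ‖F z‖ := by
    rw [hFz, hsplit]
    have h1 := norm_sub_le (C * (1 - z / p)⁻¹ + ∑' i, regTerm (c i) (u i) p z)
      (∑' i, regTerm (c i) (u i) p z)
    rw [add_sub_cancel_right, hpolar] at h1
    linarith
  have hbig : L < ‖C‖ * ‖p‖ / ‖z - p‖ := by
    rw [lt_div_iff₀ hzn]
    have := (lt_div_iff₀ hL0).1 hzC
    linarith
  have : L - M ≤ ‖F p‖ + 1 := by linarith
  rw [hL] at this hbig
  linarith

end Summit.RiemannHypothesis.RiemannHypothesis.Theorems.Splittings.ScrewBorel
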